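import Summits.HubbardSuperconductivity.HubbardSuperconductivity.Theorems.BalabanIRBirComplexStableXYRSmoothedBoxPartition
import HarnessLib

/-!
# Crux `BirComplexStableXYR` (stmt-HubbardSuperconductivity-14845), line `fat-gaussian-defect-calculus`:
# stub B1 `stub_bondWeightDefect` — the bond-weight defect lives on large fields

Registered stub (lead c8, wave 11; skeleton `Cruxes/BirComplexStableXYR/Lines/fat_gaussian_defect_calculus.lean`),
helper (`--supports`) for the crux
`Summit.HubbardSuperconductivity.HubbardSuperconductivity.Theses.BalabanIR.BirComplexStableXYR`.

**Statement.** The Fröhlich–Spencer representation carries the smoothed-box bond weights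
`W_v(η) = ∫_{[-π,π]} g_v(η - τ) dτ` (`g_v` = Mathlib's `gaussianPDFReal 0 v`, variance `v ≠ 0`).  Given the
Gaussian tail bound `γ_{0,v}{x : t ≤ |x|} ≤ 2e^{-t²/(2v)}` (`t ≥ 0`) as a hypothesis, for every bond gradient
`η` with `|η| ≤ π - a`, `a ≥ 0`, the Mayer germ satisfies `0 ≤ 1 - W_v(η) ≤ 2e^{-a²/(2v)}`.

**Proof.** (1) `W_v(η) = γ_{0,v}((η - π, η + π])` as a real number: the substitution `u = η - τ`
(landed `smoothedBox_eq_setIntegral_cell` at `n = 0`) and `gaussianReal_apply_eq_integral`.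
(2) `1 - W_v(η) = γ_{0,v}((η - π, η + π]ᶜ)` (`prob_compl_eq_one_sub`), whence `0 ≤ 1 - W_v(η)`.
(3) `|η| ≤ π - a` gives `η - π ≤ -a` and `a ≤ η + π`, so the complement of the period cell lies in
`{x : a ≤ |x|}`; monotonicity of the measure and the tail hypothesis finish.  Elementary; no definition is
introduced; sorry-free. [folklore: Fröhlich–Spencer, CMP 81 (1981) §3, smallness of the Mayer germ of the
vortex-sector bond weights off the large-field region]
-/

set_option linter.dupNamespace false -- `Summit.<S>.<S>.Theorems…` repeats the summit name (D-0017 layout)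

noncomputable section

namespace Summit.HubbardSuperconductivity.HubbardSuperconductivity.Theorems.FSUnfolding

open MeasureTheory ProbabilityTheory

/-- The smoothed-box bond weight is the centred Gaussian measure of the period cell:
`∫_{[-π,π]} g_v(η - τ) dτ = γ_{0,v}((η - π, η + π])` (as a real number), for `v ≠ 0`. [folklore] -/
theorem hsc_bondWeight_eq_toReal_gaussianReal (v : NNReal) (hv : v ≠ 0) (η : ℝ) :
    (∫ τ in Set.Icc (-Real.pi) Real.pi, gaussianPDFReal 0 v (η - τ)) =
      ((gaussianReal 0 v) (Set.Ioc (η - Real.pi) (η + Real.pi))).toReal := by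
  have h := smoothedBox_eq_setIntegral_cell v η 0
  simp only [Int.cast_zero, mul_zero, sub_zero] at h
  rw [h, gaussianReal_apply_eq_integral 0 hv, ENNReal.toReal_ofReal
    (setIntegral_nonneg measurableSet_Ioc fun x _ => gaussianPDFReal_nonneg _ _ _)]

/-- The Mayer germ of the bond weight is the centred Gaussian measure of the complement of the period
cell: `1 - ∫_{[-π,π]} g_v(η - τ) dτ = γ_{0,v}((η - π, η + π]ᶜ)` (as a real number), for `v ≠ 0`.
[folklore] -/
theorem hsc_one_sub_bondWeight_eq_toReal_compl (v : NNReal) (hv : v ≠ 0) (η : ℝ) :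
    1 - (∫ τ in Set.Icc (-Real.pi) Real.pi, gaussianPDFReal 0 v (η - τ)) =
      ((gaussianReal 0 v) (Set.Ioc (η - Real.pi) (η + Real.pi))ᶜ).toReal := by
  rw [hsc_bondWeight_eq_toReal_gaussianReal v hv η, prob_compl_eq_one_sub measurableSet_Ioc,
    ENNReal.toReal_sub_of_le prob_le_one ENNReal.one_ne_top, ENNReal.toReal_one]

/-- Off the period cell of a small gradient the field is large: if `0 ≤ a` and `|η| ≤ π - a`, then
`(η - π, η + π]ᶜ ⊆ {x : a ≤ |x|}`. [folklore] -/
theorem hsc_compl_cell_subset_tail {η a : ℝ} (hη : |η| ≤ Real.pi - a) :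
    (Set.Ioc (η - Real.pi) (η + Real.pi))ᶜ ⊆ {x : ℝ | a ≤ |x|} := by
  intro x hx
  have h1 := abs_le.1 hη
  simp only [Set.mem_compl_iff, Set.mem_Ioc, not_and_or, not_lt, not_le] at hx
  simp only [Set.mem_setOf_eq]
  rcases hx with hx | hx
  · exact le_abs.2 (Or.inr (by linarith [h1.2]))
  · exact le_abs.2 (Or.inl (by linarith [h1.1]))

/-- **stub B1 (M): the bond-weight defect lives on large fields.**  The smoothed box
`W_v(η) = ∫_{[−π,π]} φ_v(η − τ)dτ` (`φ_v` the centred Gaussian density of variance `v ≠ 0`) is the probability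
that `η + √v·Z ∈ [−π,π]`; hence, given the Gaussian tail (as a hypothesis), for `|η| ≤ π − a`, `a ≥ 0`:
`0 ≤ 1 − W_v(η) ≤ 2e^{−a²/(2v)}` — the Mayer germ `w_b = 1 − W_v(η_b)` of the bond weights is exponentially
small off the large-field region. [folklore: Fröhlich–Spencer, CMP 81 (1981) §3] -/
theorem stub_bondWeightDefect :
    ∀ (v : NNReal), v ≠ 0 →
      (∀ t : ℝ, 0 ≤ t → (ProbabilityTheory.gaussianReal 0 v) {x : ℝ | t ≤ |x|} ≤
        ENNReal.ofReal (2 * Real.exp (-(t ^ 2 / (2 * (v : ℝ)))))) →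
      ∀ (η a : ℝ), 0 ≤ a → |η| ≤ Real.pi - a →
        0 ≤ 1 - ∫ τ in Set.Icc (-Real.pi) Real.pi, ProbabilityTheory.gaussianPDFReal 0 v (η - τ) ∧
        1 - ∫ τ in Set.Icc (-Real.pi) Real.pi, ProbabilityTheory.gaussianPDFReal 0 v (η - τ) ≤
          2 * Real.exp (-(a ^ 2 / (2 * (v : ℝ)))) := by
  intro v hv htail η a ha hη
  rw [hsc_one_sub_bondWeight_eq_toReal_compl v hv η]
  refine ⟨ENNReal.toReal_nonneg, ?_⟩
  have hpos : 0 ≤ 2 * Real.exp (-(a ^ 2 / (2 * (v : ℝ)))) := by positivity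
  exact ENNReal.toReal_le_of_le_ofReal hpos
    ((measure_mono (hsc_compl_cell_subset_tail hη)).trans (htail a ha))

end Summit.HubbardSuperconductivity.HubbardSuperconductivity.Theorems.FSUnfolding
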